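import Summits.CriticalPhenomena.PercolationContinuityZ3.Theorems.SahiMasterFamilyBilinFive
import Summits.CriticalPhenomena.PercolationContinuityZ3.Theorems.SahiMasterFamilyBlockCoefFivePairs
import Summits.CriticalPhenomena.PercolationContinuityZ3.Theorems.SahiMasterFamilyBlockCoefFivePoints

/-!
# BILIN(5), SDH♭-LIN(5), SDH♭(5) in the kernel: the block coefficients on five points in closed form and `bil h β = bilinForm_five h β − 120·h_univ`

Unit `prim-masterthm-p4` (gen 19; crux anchor stmt-CriticalPhenomena-4575, helper work; memo
`run/shared/lean/prim/prim-masterthm/prim-masterthm-p4/P4-GEN19-REPORT.md` §2c).  Companion of `…Bilin` (typed `SDHFlat.Bilin`), `…BilinFive` (`HFlat.bilinForm_five_nonneg`,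
the k = 5 routing for general weights), `…SDHFlatThree` (block coefficients of co-dimension ≤ 2).

The missing identification (R22 of the memo): for `|Bᶜ| = 3, 4` the block coefficient `κ_B(β) = −Φ_{Bᶜ}(β|_{Bᶜ})` is put in closed form on `Fin 5` by an explicit
equivalence `Fin 3 ≃ Bᶜ` / `Fin 4 ≃ Bᶜ` (`SDHFlat.blockCoef_eq_neg_phiSet_of_equiv` + `phiSet_three` / `phiSet_four`; the fifteen set images by `decide`), giving all 31
coefficients; then **`bil_five_eq`**: `SDHFlat.bil h β = HFlat.bilinForm_five h β − 120·h univ` (the memo's `B_5(h,d) = Σ_S h_S c_d(S) − 5!·h_univ`, using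
`phiSet_cap_eq_sum_blockCoef` for the cap terms), and the KERNEL RUNGS **`bilin_five : Bilin 5`**, **`sdhFlatLin_five : SDHFlatLin 5`**, **`sdhFlatNonneg_five :
SDHFlatNonneg 5`** (and H♭(5) once more).  HONEST FRAMING: k = 5 of the BILIN/SDH♭/H♭ ladder is now kernel; k ≥ 6, (UC-hull)_k (k ≥ 8), Sahi's `C_k` and the master
theorem remain OPEN.  Axioms standard. [this work]
-/

noncomputable section

open scoped Classical

namespace Summit.CriticalPhenomena.PercolationContinuityZ3.Theorems

namespace SDHFlat

open Finset Function
open Literature.Combinatorics.Sahi2008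
open PrincipalCapBeta (phiSet)

/-- Summing over the thirty-two subsets of `Fin 5`. [folklore] -/
theorem sum_finset_fin_five (F : Finset (Fin 5) → ℝ) :
    ∑ B : Finset (Fin 5), F B = (((((F ∅ + F {4}) + (F {3} + F {3, 4})) + ((F {2} + F {2, 4}) + (F {2, 3} + F {2, 3, 4}))) + (((F {1} + F {1, 4}) + (F {1, 3} + F {1, 3, 4})) + ((F {1, 2} + F {1, 2, 4}) + (F {1, 2, 3} + F {1, 2, 3, 4})))) + ((((F {0} + F {0, 4}) + (F {0, 3} + F {0, 3, 4})) + ((F {0, 2} + F {0, 2, 4}) + (F {0, 2, 3} + F {0, 2, 3, 4}))) + (((F {0, 1} + F {0, 1, 4}) + (F {0, 1, 3} + F {0, 1, 3, 4})) + ((F {0, 1, 2} + F {0, 1, 2, 4}) + (F {0, 1, 2, 3} + F univ))))) := by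
  have hU : (univ : Finset (Fin 5)) = insert 0 (insert 1 (insert 2 (insert 3 (insert 4 ∅)))) := by decide
  rw [← powerset_univ, hU]
  simp only [sum_powerset_insert (show (0 : Fin 5) ∉ (insert 1 (insert 2 (insert 3 (insert 4 ∅))) : Finset (Fin 5)) by decide),
    sum_powerset_insert (show (1 : Fin 5) ∉ (insert 2 (insert 3 (insert 4 ∅)) : Finset (Fin 5)) by decide),
    sum_powerset_insert (show (2 : Fin 5) ∉ (insert 3 (insert 4 ∅) : Finset (Fin 5)) by decide),
    sum_powerset_insert (show (3 : Fin 5) ∉ (insert 4 ∅ : Finset (Fin 5)) by decide),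
    sum_powerset_insert (show (4 : Fin 5) ∉ (∅ : Finset (Fin 5)) by decide), powerset_empty, sum_singleton]
  simp only [insert_empty]

set_option maxHeartbeats 8000000 in
/-- **`B_5(h, β) = Σ_S h_S·c_d(S) − 120·h_univ`**: the tree's bilinear form `SDHFlat.bil` on five points IS the explicit form `HFlat.bilinForm_five`. [this work] -/
theorem bil_five_eq (h β : Finset (Fin 5) → ℝ) : bil h β = HFlat.bilinForm_five h β - 120 * h univ := by
  have κ0 := kappa_0 β
  have κ1 := kappa_1 β
  have κ01 := kappa_01 β
  have κ2 := kappa_2 β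
  have κ02 := kappa_02 β
  have κ12 := kappa_12 β
  have κ012 : blockCoef β ({0, 1, 2} : Finset (Fin 5)) = β {3} * β {4} - β {3, 4} :=
    blockCoef_of_compl_eq_pair (k := 4) β (by decide) (by decide)
  have κ3 := kappa_3 β
  have κ03 := kappa_03 β
  have κ13 := kappa_13 β
  have κ013 : blockCoef β ({0, 1, 3} : Finset (Fin 5)) = β {2} * β {4} - β {2, 4} :=
    blockCoef_of_compl_eq_pair (k := 4) β (by decide) (by decide)
  have κ23 := kappa_23 β
  have κ023 : blockCoef β ({0, 2, 3} : Finset (Fin 5)) = β {1} * β {4} - β {1, 4} :=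
    blockCoef_of_compl_eq_pair (k := 4) β (by decide) (by decide)
  have κ123 : blockCoef β ({1, 2, 3} : Finset (Fin 5)) = β {0} * β {4} - β {0, 4} :=
    blockCoef_of_compl_eq_pair (k := 4) β (by decide) (by decide)
  have κ0123 : blockCoef β ({0, 1, 2, 3} : Finset (Fin 5)) = -β {4} :=
    blockCoef_of_compl_eq_singleton (k := 4) β (by decide)
  have κ4 := kappa_4 β
  have κ04 := kappa_04 β
  have κ14 := kappa_14 β
  have κ014 : blockCoef β ({0, 1, 4} : Finset (Fin 5)) = β {2} * β {3} - β {2, 3} :=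
    blockCoef_of_compl_eq_pair (k := 4) β (by decide) (by decide)
  have κ24 := kappa_24 β
  have κ024 : blockCoef β ({0, 2, 4} : Finset (Fin 5)) = β {1} * β {3} - β {1, 3} :=
    blockCoef_of_compl_eq_pair (k := 4) β (by decide) (by decide)
  have κ124 : blockCoef β ({1, 2, 4} : Finset (Fin 5)) = β {0} * β {3} - β {0, 3} :=
    blockCoef_of_compl_eq_pair (k := 4) β (by decide) (by decide)
  have κ0124 : blockCoef β ({0, 1, 2, 4} : Finset (Fin 5)) = -β {3} :=
    blockCoef_of_compl_eq_singleton (k := 4) β (by decide)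
  have κ34 := kappa_34 β
  have κ034 : blockCoef β ({0, 3, 4} : Finset (Fin 5)) = β {1} * β {2} - β {1, 2} :=
    blockCoef_of_compl_eq_pair (k := 4) β (by decide) (by decide)
  have κ134 : blockCoef β ({1, 3, 4} : Finset (Fin 5)) = β {0} * β {2} - β {0, 2} :=
    blockCoef_of_compl_eq_pair (k := 4) β (by decide) (by decide)
  have κ0134 : blockCoef β ({0, 1, 3, 4} : Finset (Fin 5)) = -β {2} :=
    blockCoef_of_compl_eq_singleton (k := 4) β (by decide)
  have κ234 : blockCoef β ({2, 3, 4} : Finset (Fin 5)) = β {0} * β {1} - β {0, 1} :=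
    blockCoef_of_compl_eq_pair (k := 4) β (by decide) (by decide)
  have κ0234 : blockCoef β ({0, 2, 3, 4} : Finset (Fin 5)) = -β {1} :=
    blockCoef_of_compl_eq_singleton (k := 4) β (by decide)
  have κ1234 : blockCoef β ({1, 2, 3, 4} : Finset (Fin 5)) = -β {0} :=
    blockCoef_of_compl_eq_singleton (k := 4) β (by decide)
  have κu : blockCoef β (univ : Finset (Fin 5)) = 1 := blockCoef_univ β
  have c0 : ({0} : Finset (Fin 5)).card = 1 := by decide
  have c1 : ({1} : Finset (Fin 5)).card = 1 := by decide
  have c01 : ({0, 1} : Finset (Fin 5)).card = 2 := by decide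
  have c2 : ({2} : Finset (Fin 5)).card = 1 := by decide
  have c02 : ({0, 2} : Finset (Fin 5)).card = 2 := by decide
  have c12 : ({1, 2} : Finset (Fin 5)).card = 2 := by decide
  have c012 : ({0, 1, 2} : Finset (Fin 5)).card = 3 := by decide
  have c3 : ({3} : Finset (Fin 5)).card = 1 := by decide
  have c03 : ({0, 3} : Finset (Fin 5)).card = 2 := by decide
  have c13 : ({1, 3} : Finset (Fin 5)).card = 2 := by decide
  have c013 : ({0, 1, 3} : Finset (Fin 5)).card = 3 := by decide
  have c23 : ({2, 3} : Finset (Fin 5)).card = 2 := by decide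
  have c023 : ({0, 2, 3} : Finset (Fin 5)).card = 3 := by decide
  have c123 : ({1, 2, 3} : Finset (Fin 5)).card = 3 := by decide
  have c0123 : ({0, 1, 2, 3} : Finset (Fin 5)).card = 4 := by decide
  have c4 : ({4} : Finset (Fin 5)).card = 1 := by decide
  have c04 : ({0, 4} : Finset (Fin 5)).card = 2 := by decide
  have c14 : ({1, 4} : Finset (Fin 5)).card = 2 := by decide
  have c014 : ({0, 1, 4} : Finset (Fin 5)).card = 3 := by decide
  have c24 : ({2, 4} : Finset (Fin 5)).card = 2 := by decide
  have c024 : ({0, 2, 4} : Finset (Fin 5)).card = 3 := by decide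
  have c124 : ({1, 2, 4} : Finset (Fin 5)).card = 3 := by decide
  have c0124 : ({0, 1, 2, 4} : Finset (Fin 5)).card = 4 := by decide
  have c34 : ({3, 4} : Finset (Fin 5)).card = 2 := by decide
  have c034 : ({0, 3, 4} : Finset (Fin 5)).card = 3 := by decide
  have c134 : ({1, 3, 4} : Finset (Fin 5)).card = 3 := by decide
  have c0134 : ({0, 1, 3, 4} : Finset (Fin 5)).card = 4 := by decide
  have c234 : ({2, 3, 4} : Finset (Fin 5)).card = 3 := by decide
  have c0234 : ({0, 2, 3, 4} : Finset (Fin 5)).card = 4 := by decide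
  have c1234 : ({1, 2, 3, 4} : Finset (Fin 5)).card = 4 := by decide
  have cu : (univ : Finset (Fin 5)).card = 5 := by rw [card_univ, Fintype.card_fin]
  have f2 : Nat.factorial 2 = 2 := rfl
  have f3 : Nat.factorial 3 = 6 := rfl
  have f4 : Nat.factorial 4 = 24 := rfl
  have hcap : ∀ t : Fin 5, phiSet 5 (fun S => if t ∈ S then 1 else β S) =
      ∑ B : Finset (Fin 5), (if t ∈ B then ((B.card - 1).factorial : ℝ) * blockCoef β B else 0) :=
    fun t => phiSet_cap_eq_sum_blockCoef (k := 4) β t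
  unfold bil HFlat.bilinForm_five
  rw [Fin.sum_univ_five, hcap 0, hcap 1, hcap 2, hcap 3, hcap 4, sum_finset_fin_five, sum_finset_fin_five, sum_finset_fin_five,
    sum_finset_fin_five, sum_finset_fin_five, sum_finset_fin_five]
  simp +decide only [Fin.isValue, if_true, if_false, card_empty, c0, c1, c01, c2, c02, c12, c012, c3, c03, c13, c013, c23, c023, c123, c0123, c4, c04, c14, c014, c24, c024, c124, c0124, c34, c034, c134, c0134, c234, c0234, c1234, cu, κ0, κ1, κ01, κ2, κ02, κ12, κ012, κ3, κ03, κ13, κ013, κ23, κ023, κ123, κ0123, κ4, κ04, κ14, κ014, κ24, κ024, κ124, κ0124, κ34, κ034, κ134, κ0134, κ234, κ0234, κ1234, κu,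
    Nat.cast_zero, zero_mul, Nat.cast_one, Nat.cast_ofNat, Nat.factorial_zero, Nat.factorial_one, f2, f3, f4, Nat.sub_self, Nat.add_one_sub_one, one_mul, mul_one]
  ring

/-- Two distinct co-points of a finite set cover it. [folklore] -/
theorem erase_union_erase_eq {U : Finset (Fin 5)} {a b : Fin 5} (ha : a ∈ U) (hab : a ≠ b) : U.erase a ∪ U.erase b = U := by
  ext x
  simp only [mem_union, mem_erase]
  constructor
  · rintro (⟨_, hx⟩ | ⟨_, hx⟩) <;> exact hx
  · intro hx
    by_cases hxa : x = a
    · subst hxa; exact Or.inr ⟨hab, hx⟩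
    · exact Or.inl ⟨hxa, hx⟩

/-- **BILIN(5)** (`SDHFlat.Bilin 5`): the bilinear roof on five points, from the explicit routing `HFlat.bilinForm_five_nonneg` and `bil_five_eq`. [this work] -/
theorem bilin_five : Bilin 5 := by
  intro h hh0 hsub htop β h0 h1 _ hu
  have hcp : ∀ (U : Finset (Fin 5)) (a b : Fin 5), a ∈ U → b ∈ U → a ≠ b → h U ≤ h (U.erase a) + h (U.erase b) := by
    intro U a b ha _ hab
    have := hsub (U.erase a) (U.erase b)
    rwa [erase_union_erase_eq ha hab] at this
  rw [bil_five_eq, htop, mul_zero, sub_zero]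
  exact HFlat.bilinForm_five_nonneg h β hh0 hcp h0 h1 hu

/-- **SDH♭-LIN(5)**. [this work] -/
theorem sdhFlatLin_five : SDHFlatLin 5 := sdhFlatLin_of_bilin bilin_five

/-- **SDH♭(5)** (`SDHFlatNonneg 5`). [this work] -/
theorem sdhFlatNonneg_five : SDHFlatNonneg 5 := sdhFlatNonneg_of_bilin bilin_five

/-- H♭-LIN(5) through the roof (consistency with `HFlat.hFlatLin_five`). [this work] -/
theorem hFlatLin_five' : HFlat.HFlatLin 5 := hFlatLin_of_bilin bilin_five

end SDHFlat

end Summit.CriticalPhenomena.PercolationContinuityZ3.Theorems
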